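import Summits.Schanuel.Schanuel.Theorems.RootDecomp1BPeriodKernelFloor02
import Literature.AlgebraicGeometry.Frobenioids.LogPrimesLinearIndependent

/-!
# `RootDecomp1BFinitePinningFloor` — part 01 of 04 (`RootDecomp1BFinitePinningFloor01`): §1 helpers, §2 transcendence of `π` over `A` and the `A`-freeness of its powers (`transcendental_pi_A`, `linearIndependent_pi_pow_A`, `linearIndependent_one_pi_piSq`, `linearIndependent_piI_pow`), §3 PINNED SHEARS (`φ π = 0`): the true kernel, the period plane, Nesterenko verbatim, `E_eq_exp_of`, the transcendence package of every shear (`transcendencePackage_shear`, `periodPackage_of`)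

PORT in four parts (≤ 400 lines each, shared namespace `Summit.Schanuel.Schanuel.Theorems.RootDecomp1BFinitePinningFloor`, each part importing the previous; `--supports stmt-Schanuel-24622`) of the decomp-schanuel lens-4 kernel file `HOME/decomp-schanuel-lens-4/g23/FinitePinningFloor.lean` (gen 23, 2026-08-30, sha256 d4bafcab9e6edb89…; `lean check` rc 0 · 0 sorry · standard axioms). Overview of the whole port:

# FINITE PINNING FLOOR — `KleinPolarSchanuel` (crux `stmt-Schanuel-24622`), `SchanuelRank 2` and the summit text are FALSE WITHOUT a property of `exp` beyond the PERIOD PACKAGE plus agreement with `exp` on `H ⊕ iH` for an `A`-HYPERPLANE `H ⊂ ℝ` containing ANY prescribed finite-dimensional `A`-subspace (`A = ℚ̄ ∩ ℝ`); the rank cost of the period is ZERO; K5-X reduces to `2cos log 2 ∉ ℚ̄ ⊕ ℚ̄π`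

Negative-side certificate no. 3 in `_false_without_` form for the crux `KleinPolarSchanuel` of route
`Summits/Schanuel/Schanuel/Theses/RootDecomp1B.lean` (decomp-schanuel programme, lens «minimal
counterexample / extremal reduction», generation 23, 2026-08-30; `--supports stmt-Schanuel-24622`),
sequel to the TRANSCENDENCE PACKAGE FLOOR `RootDecomp1BTranscendencePackageFloor01`–`05` (TPF: the
algebraic-point package (E1)–(E4) does not give `X(1)` / `S(2)`) and the PERIOD-KERNEL FLOOR
`RootDecomp1BPeriodKernelFloor01`–`02` (PKF: adding (P1) the true kernel `2πiℤ`, (P2) `E = exp` on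
`ℚ̄ ⊕ ℚ̄π`, (P3) Nesterenko verbatim does not give `X(2)` / `S(3)`). Nothing here proves or refutes
a route item. Sorry-free, standard axioms; consumes the tree theorems `baker_holds`,
`transcendental_pi_holds`, `Frobenioids.linearIndependent_rat_log_primes` and the named fact
`nesterenko` (as a hypothesis `hN`, exactly as PKF); introduces no fact.

PKF02 recorded two open questions on the RANK axis («rank cost of the period»): (K5-S) its model
`E₁` (shear `e^π ↦ log 2`) was only shown to fail `S(3)` — does the period package perhaps BUY
`S(2)`? (K5-X) does it buy the length-one cell `X(1)`? And its floor pinned `exp` only on the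
period plane. This file answers K5-S (no), makes the floor UNIFORM in the pinned set, shows that
the models evade REGULARITY channels only by being non-measurable, and reduces K5-X to one named
uncertified membership.

## Construction (namespace `Summit.Schanuel.Schanuel.Theorems.RootDecomp1BFinitePinningFloor`)

A PINNED SHEAR is a shear `S = (φ, u, ℓ)` of TPF02 (`φ : ℝ → A` `A`-linear, `φ 1 = 0`, `φ u = 1`,
`φ ℓ ≠ 0`; `θ = id + (φ∘Re + iφ∘Im)·d`, `d = ℓ - u`; `E = exp ∘ θ`, a surjective homomorphism
`ℂ → ℂˣ`) with `φ π = 0` (§3). Then `θ` fixes `ℚ̄ ⊕ ℚ̄π ∋ 2πi` pointwise, so (P1) `ker E = 2πiℤ`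
(`trueKernel_of`), (P2) `E = exp` on the period plane (`agreesOnPeriodPlane_of`), `E π = e^π`,
`E(iπ) = -1`, and (P3) Nesterenko's statement holds VERBATIM for `E` (`nesterenkoE_of`); (E1)–(E4)
hold for every shear (`transcendencePackage_shear`, TPF03); more generally `E = exp` on `H_S ⊕ iH_S`
for the FIXED SPACE `H_S = ker φ`, an `A`-HYPERPLANE of `ℝ` (`ℝ = H_S ⊕ A·u`: `fixedSpace_sup_span_u`,
`fixedSpace_inf_span_u`, `agreesOn_fixedSpace`). With `u = π^k` (`k ≠ 1`) and `ℓ = log p`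
(`p` prime): `E(π^k) = p`, `E(iπ^k) = p^i`, whence `¬ S_E(2)` at the `ℚ`-free pair `(iπ, π^k)`
(`trdeg ℚ(iπ, π^k, -1, p) = 1`; `not_schanuelRankE_two_of`) and `¬ X_E(2)` at the `ℚ`-free real pair
`r = (π, π^k)` (eight generators algebraic over `ℚ(π, e^π, p^i)`, `2 + 2 ≤ 3` fails;
`not_kleinPolarE_of`), while the length-one cell `X_E(1)` at `r = (π)` HOLDS (Nesterenko;
`kleinPolar_pi_cell_of`). No shear with `d ≠ 0` is Borel-measurable on `ℝ` (`not_measurable_E_ofReal`: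
a measurable additive `x ↦ φ(x)d` would be continuous by Steinhaus, hence `ℝ`-linear, hence `0`).

* §4 THE EXPLICIT MODEL `E₂` = the shear `π² ↦ log 2` fixing `ℚ̄ ⊕ ℚ̄π` (`exists_phi_piSq`: `1, π, π²`
  are `A`-free by the transcendence of `π` over `A`; non-degeneracy in the dependent case from
  `log 2 ∉ A ⊕ Aπ`, Baker, PKF01). Its CONSTRUCTION NEEDS NO HYPOTHESIS (PKF's `E₁` needed `hN` to be
  built); Nesterenko enters only as item (P3). `E₂(π²) = 2 ≠ e^{π²}` (`E₂_piSq_ne_exp`),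
  `E₂(iπ²) = 2^i`, `E₂` discontinuous and non-measurable.
* §5 BAKER for the logarithms of the primes: `log 2, log 3, log 5, …` are `A`-linearly independent
  (`linearIndependent_logPrime_A`, from `baker_holds` at the `ℚ`-free logarithms of the primes —
  unique factorisation, the tree's `Frobenioids.linearIndependent_rat_log_primes`); with the
  `A`-freeness of the powers of `π` this yields, for every finite-dimensional `F ∋ 1, π`, some
  `π^k ∉ F`, some `log p ∉ F + A·π^k`, and a functional killing `F` with `φ(π^k) = φ(log p) = 1`
  (`exists_pinned_shear`, functionals on `ℝ ⧸ F`).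

## Verdicts and headlines (`_false_without_` = a proof of the statement must use a property of `exp` outside the list)

* `not_schanuelRankE_E₂_two`, `schanuelRank_two_false_without_channel_beyond_periods (hN)`:
  **K5-S settled — the RANK COST OF THE PERIOD IS ZERO**: `¬ ∀ E, PeriodPackage E → S_E(2)`. With
  (E1)–(E4) alone the first failure of `S_E(·)` is at length 2 (TPF05, `E₀`); adding (P1)–(P3) it
  STAYS at length 2 (`E₂` at `(iπ, π²)`; PKF02 had length 3).
* `not_kleinPolarE_E₂`, `kleinPolarSchanuel_false_without_channel_beyond_kernel_and_period_plane`: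
  the crux does not follow from (E1)–(E4) + (P1) + (P2) — UNCONDITIONALLY (PKF02's headline carried
  `hN` because its model did).
* `hyperplanePinningFloor (F)`, `finitePinningFloor (F)`, `finiteSetPinningFloor (T)`,
  `…_periodPackage (hN)`: for EVERY finite-dimensional `A`-subspace `F ⊂ ℝ` (every finite set `T` of
  reals) there are an `A`-hyperplane `H ⊇ F` and an `E` with (E1)–(E4), (P1)–(P3), `E = exp` on
  `H ⊕ iH ⊇ F ⊕ iF`, discontinuous, NON-MEASURABLE, failing `S(2)`, `X(2)` and the summit text.
* `kleinPolarSchanuel_false_without_channel_beyond_finite_pinning (hN) (F)`,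
  `…_beyond_hyperplane_pinning (hN) (F)`, `schanuelRank_two_… (hN) (F)`, `schanuel_… (hN) (F)`,
  and the `hN`-free `kleinPolarSchanuel_false_without_channel_beyond_finite_pinning' (F)`:
  `¬ ∀ E, PeriodPackage E → AgreesOn E F → X_E` etc.
* `finitePinning_exp_dictionary`: `exp` has the period package and agrees with itself on every `F`;
  at `E = exp` the failing statements ARE the crux (stmt-Schanuel-24622), the tree's `SchanuelRank 2`
  and the summit `Schanuel` (`Iff.rfl`, TPF01).
* §7 `kFiveX_reduction`, `kFiveX_of_u₀_not_mem`: **K5-X REDUCED** — a model with (E1)–(E4), (P1)–(P3)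
  failing the LENGTH-ONE cell `X_E(1)` exists as soon as ONE real pair `(r, s)` with
  `r, s ∉ A ⊕ Aπ` and `trdeg ℚ(r, e^s, e^{is}) ≤ 1` is certified (the pinned shear `r ↦ s`; for the
  shear family the condition is also necessary, a pinned shear being `exp` on `ker φ ⊕ i ker φ`).
  TPF04's pair `(u₀, ℓ₀) = (2cos log 2, log 2)` meets everything (`e^{ℓ₀} = 2`, `e^{iℓ₀} = 2^i`,
  `u₀ ∈ ℚ(2^i)`, `log 2 ∉ A ⊕ Aπ` by Baker) EXCEPT `u₀ ∉ A ⊕ Aπ`, i.e. (as `u₀` is transcendental)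
  `π ∉ ℚ̄(2^i)` — a case of Schanuel's conjecture for `(iπ, log 2, i log 2)` outside
  HL/LW/GS/Baker/Nesterenko. K5-X is therefore EXACTLY as hard as that membership for this method.

## Reading for the crux, and what is NOT claimed

Every channel in the list is a statement about VALUES of `exp` on an `A`-submodule of `ℂ` of
`A`-codimension two (`H ⊕ iH`, `H` a real `A`-hyperplane through `1, π` and any prescribed
finite-dimensional `F`) plus transcendence statements at algebraic points and Nesterenko's theorem;
none of it decides `X(2)` or `S(2)`. What separates `exp` from the models is REGULARITY: every model
is a non-measurable function (and must be: a measurable shear is `exp`). So the floor constrains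
exactly the «black-box» deductions — LW, HL, GS, Baker, Nesterenko, the kernel, any finite table of
values of `exp` — and says that a proof of `KleinPolarSchanuel` has to use `exp` as an analytic
object (the transcendence METHOD: order of growth, Schwarz lemma, zero estimates, differential
equation), not as a list of its known values. It does NOT say the crux is false or independent of
anything. NOT claimed: K5-X itself (open, §7); `trdeg ℚ(π, e^{π²}) = 2` (the cell of `exp` that `E₂`
kills is OPEN for `exp`, consistent with the floor); six exponentials / `LocalSurplusBudget` /
`TameDefectZeroStep` for `E₂`; anything about `F` of infinite dimension (pinning `exp` on `A[π]` or
on the Baker module `{β₀ + Σ βᵢ log αᵢ}` would need `log p ∉ A[π]`-type facts that are open).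
-/

noncomputable section

open Complex

namespace Summit.Schanuel.Schanuel.Theorems.RootDecomp1BFinitePinningFloor

open Summit.Schanuel.Schanuel.Theorems.RootDecomp1BTranscendencePackageFloor
open Summit.Schanuel.Schanuel.Theorems.RootDecomp1BPeriodKernelFloor
open Literature.NumberTheory.Transcendental (nesterenko baker_holds SchanuelRank transcendental_pi_holds)

/-! ## §1 Helpers -/

/-- `2` is algebraic. [folklore] -/
private theorem alg_two : IsAlgebraic ℚ (2 : ℂ) := by
  have h : IsAlgebraic ℚ ((2 : ℕ) : ℂ) := isAlgebraic_nat 2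
  simpa using h

/-- `2 ∈ ℚ̄`. [folklore] -/
private theorem two_mem_Qb' : (2 : ℂ) ∈ Qb := mem_Qb_iff.mpr alg_two

/-- `e^{log p} = p` in `ℂ` for a positive natural number `p`. [folklore] -/
theorem cexp_log_natCast {p : ℕ} (hp : 0 < p) : cexp ((Real.log p : ℝ) : ℂ) = (p : ℂ) := by
  rw [← Complex.ofReal_exp, Real.exp_log (by exact_mod_cast hp), Complex.ofReal_natCast]

/-! ## §2 Transcendence of `π` over `A = ℚ̄ ∩ ℝ` and the `A`-independence of its powers -/

/-- `π` is transcendental over the real algebraic numbers `A` (Lindemann, plus `A/ℚ` algebraic).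
[cite: Lindemann1882, via BakerTNT1975 Ch. 1 Theorem 1.3, p. 5] -/
theorem transcendental_pi_A : Transcendental A Real.pi := by
  haveI : Algebra.IsAlgebraic ℚ A := algebraicClosure.isAlgebraic ℚ ℝ
  intro h
  exact transcendental_pi_holds (h.restrictScalars ℚ)

/-- A relation `∑ cᵢ x^{eᵢ} = 0` with distinct exponents and coefficients from `R` at a real `x`
transcendental over `R` is trivial. [folklore] -/
theorem pow_relation_trivial_of_transcendental {R : Type*} [CommRing R] [Algebra R ℝ] {x : ℝ}
    (hx : Transcendental R x) {ι : Type*} [Fintype ι] (e : ι → ℕ) (he : Function.Injective e)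
    (c : ι → R) (hc : ∑ i, algebraMap R ℝ (c i) * x ^ e i = 0) : ∀ i, c i = 0 := by
  classical
  intro i
  let P : Polynomial R := ∑ j, Polynomial.monomial (e j) (c j)
  have hP : Polynomial.aeval x P = 0 := by
    simp only [P, map_sum, Polynomial.aeval_monomial]
    exact hc
  have h0 : P = 0 := (transcendental_iff.mp hx) P hP
  have h1 := congrArg (fun Q => Polynomial.coeff Q (e i)) h0
  simp only [P, Polynomial.finsetSum_coeff, Polynomial.coeff_monomial, Polynomial.coeff_zero] at h1
  rwa [Finset.sum_eq_single i (fun j _ hj => if_neg fun h => hj (he h)) (fun h => absurd (Finset.mem_univ i) h),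
    if_pos rfl] at h1

/-- Distinct powers of `π` are linearly independent over `A = ℚ̄ ∩ ℝ`. [cite: Lindemann1882, via BakerTNT1975 Ch. 1 Theorem 1.3, p. 5] -/
theorem linearIndependent_pi_pow_A {ι : Type*} [Fintype ι] (e : ι → ℕ) (he : Function.Injective e) :
    LinearIndependent A fun i => Real.pi ^ e i := by
  rw [Fintype.linearIndependent_iff]
  intro c hc
  refine pow_relation_trivial_of_transcendental transcendental_pi_A e he c ?_
  rw [← hc]
  refine Finset.sum_congr rfl fun i _ => ?_
  rw [Algebra.smul_def]

/-- Distinct powers of `π` are linearly independent over `ℚ`. [cite: Lindemann1882, via BakerTNT1975 Ch. 1 Theorem 1.3, p. 5] -/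
theorem linearIndependent_pi_pow_rat {ι : Type*} [Fintype ι] (e : ι → ℕ) (he : Function.Injective e) :
    LinearIndependent ℚ fun i => Real.pi ^ e i := by
  have hπ : Transcendental ℚ Real.pi := transcendental_pi_holds
  rw [Fintype.linearIndependent_iff]
  intro c hc
  refine pow_relation_trivial_of_transcendental hπ e he c ?_
  rw [← hc]
  refine Finset.sum_congr rfl fun i _ => ?_
  rw [Algebra.smul_def]

/-- `1, π, π²` are linearly independent over `A = ℚ̄ ∩ ℝ`. [cite: Lindemann1882, via BakerTNT1975 Ch. 1 Theorem 1.3, p. 5] -/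
theorem linearIndependent_one_pi_piSq : LinearIndependent A ![(1 : ℝ), Real.pi, Real.pi ^ 2] := by
  have he : Function.Injective (![0, 1, 2] : Fin 3 → ℕ) := by
    intro i j hij
    fin_cases i <;> fin_cases j <;> simp at hij ⊢
  have e : (![(1 : ℝ), Real.pi, Real.pi ^ 2]) = fun i => Real.pi ^ (![0, 1, 2] : Fin 3 → ℕ) i := by
    funext i
    fin_cases i <;> simp
  rw [e]
  exact linearIndependent_pi_pow_A _ he

/-- `π, π^k` (`k ≠ 1`) are `ℚ`-linearly independent reals. [cite: Lindemann1882, via BakerTNT1975 Ch. 1 Theorem 1.3, p. 5] -/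
theorem linearIndependent_pi_pow {k : ℕ} (hk : k ≠ 1) : LinearIndependent ℚ ![Real.pi, Real.pi ^ k] := by
  have he : Function.Injective (![1, k] : Fin 2 → ℕ) := by
    intro i j hij
    fin_cases i <;> fin_cases j <;> simp at hij ⊢ <;> omega
  have e : (![Real.pi, Real.pi ^ k]) = fun i => Real.pi ^ (![1, k] : Fin 2 → ℕ) i := by
    funext i
    fin_cases i <;> simp
  rw [e]
  exact linearIndependent_pi_pow_rat _ he

/-- `iπ, π^k` are `ℚ`-linearly independent complex numbers (imaginary vs. nonzero real).
[folklore] -/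
theorem linearIndependent_piI_pow (k : ℕ) :
    LinearIndependent ℚ ![(Real.pi : ℂ) * I, (Real.pi : ℂ) ^ k] := by
  rw [LinearIndependent.pair_iff]
  intro s t h
  rw [Rat.smul_def, Rat.smul_def, ← Complex.ofReal_pow] at h
  have hk : (Real.pi ^ k : ℝ) ≠ 0 := (pow_pos Real.pi_pos k).ne'
  have hre := congrArg Complex.re h
  have him := congrArg Complex.im h
  simp only [Complex.add_re, Complex.add_im, Complex.mul_re, Complex.mul_im, Complex.ofReal_re,
    Complex.ofReal_im, Complex.I_re, Complex.I_im, Complex.ratCast_re, Complex.ratCast_im,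
    Complex.zero_re, Complex.zero_im, mul_zero, zero_mul, mul_one, sub_zero, add_zero,
    zero_add] at hre him
  have ht : (t : ℝ) = 0 := by
    rcases mul_eq_zero.mp hre with h' | h'
    · exact h'
    · exact absurd h' hk
  have hs : (s : ℝ) = 0 := by
    rcases mul_eq_zero.mp him with h' | h'
    · exact h'
    · exact absurd h' Real.pi_ne_zero
  exact ⟨by exact_mod_cast hs, by exact_mod_cast ht⟩

/-! ## §3 PINNED SHEARS: a shear `(φ, u, ℓ)` of part TPF02 whose functional kills `π` has the TRUE
kernel `2πiℤ`, agrees with `exp` on the period plane `ℚ̄ ⊕ ℚ̄π` and on `F ⊕ iF` for every `F`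
killed by `φ`, satisfies Nesterenko verbatim — and if `u = π^k`, `ℓ = log p` it violates `S(2)` at
`(iπ, π^k)` and `X(2)` at `(π, π^k)` -/

section Pinned

variable (S : Shear)

/-- `φR π = 0` when `φ π = 0`. [folklore] -/
theorem φR_pi_of (h : S.φ Real.pi = 0) : S.φR Real.pi = 0 := by
  show ((S.φ Real.pi : A) : ℝ) = 0
  rw [h]
  rfl

/-- `θ π = π`. [folklore] -/
theorem θ_pi_of (h : S.φ Real.pi = 0) : S.θ (Real.pi : ℂ) = Real.pi := by
  rw [Shear.θ_ofReal, φR_pi_of S h, zero_mul, add_zero]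

/-- `θ (q·π) = q·π` for `q ∈ ℚ̄`. [folklore] -/
theorem θ_mul_pi_of (h : S.φ Real.pi = 0) {q : ℂ} (hq : q ∈ Qb) :
    S.θ (q * Real.pi) = q * Real.pi := by
  rw [Shear.θ_mul_of_mem _ hq, θ_pi_of S h]

/-- `θ` fixes `ℚ̄ ⊕ ℚ̄·π` pointwise. [folklore] -/
theorem θ_add_mul_pi_of (h : S.φ Real.pi = 0) {p q : ℂ} (hp : p ∈ Qb) (hq : q ∈ Qb) :
    S.θ (p + q * Real.pi) = p + q * Real.pi := by
  rw [Shear.θ_add, Shear.θ_of_mem _ hp, θ_mul_pi_of S h hq]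

/-- `θ (2πi) = 2πi`. [folklore] -/
theorem θ_two_pi_I_of (h : S.φ Real.pi = 0) : S.θ (2 * Real.pi * I) = 2 * Real.pi * I := by
  have e : (2 * Real.pi * I : ℂ) = (2 * I) * Real.pi := by ring
  rw [e, θ_mul_pi_of S h (mul_mem two_mem_Qb' I_mem_Qb)]

/-- The kernel generator is `τ = 2πi`. [folklore] -/
theorem τ_eq_of (h : S.φ Real.pi = 0) : S.τ = 2 * Real.pi * I := by
  apply S.θ_injective
  rw [Shear.θ_τ, θ_two_pi_I_of S h]

/-- (P1) TRUE KERNEL `2πiℤ`. [folklore] -/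
theorem trueKernel_of (h : S.φ Real.pi = 0) : TrueKernel S.E := fun z => by
  rw [Shear.E_eq_one_iff, τ_eq_of S h]

/-- (P2) `E = exp` on the period plane `ℚ̄ ⊕ ℚ̄·π`. [folklore] -/
theorem agreesOnPeriodPlane_of (h : S.φ Real.pi = 0) : AgreesOnPeriodPlane S.E := fun p q hp hq => by
  show cexp (S.θ (p + q * Real.pi)) = _
  rw [θ_add_mul_pi_of S h (mem_Qb_iff.mpr hp) (mem_Qb_iff.mpr hq)]

/-- `E π = e^π`. [folklore] -/
theorem E_pi_of (h : S.φ Real.pi = 0) : S.E Real.pi = cexp Real.pi := by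
  show cexp (S.θ Real.pi) = _
  rw [θ_pi_of S h]

/-- `E (iπ) = -1`. [folklore] -/
theorem E_pi_mul_I_of (h : S.φ Real.pi = 0) : S.E ((Real.pi : ℂ) * I) = -1 := by
  show cexp (S.θ ((Real.pi : ℂ) * I)) = _
  rw [show ((Real.pi : ℂ) * I) = I * Real.pi by ring, θ_mul_pi_of S h I_mem_Qb,
    show (I * Real.pi : ℂ) = Real.pi * I by ring, Complex.exp_pi_mul_I]

/-- (P3) Nesterenko verbatim for `E` (`E π = e^π`). [cite: Nesterenko1996SbMath, Theorem 1 and its corollaries] -/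
theorem nesterenkoE_of (hN : nesterenko) (h : S.φ Real.pi = 0) : NesterenkoE S.E := by
  unfold NesterenkoE
  rw [E_pi_of S h]
  exact nesterenkoE_exp hN

/-- `E u = e^ℓ` (the shear moves `u` to `ℓ`). [folklore] -/
theorem E_u : S.E (S.u : ℂ) = cexp (S.ℓ : ℂ) := by
  show cexp (S.θ (S.u : ℂ)) = _
  rw [Shear.θ_u]

/-- `E (iu) = e^{iℓ}`. [folklore] -/
theorem E_u_mul_I : S.E ((S.u : ℂ) * I) = cexp ((S.ℓ : ℂ) * I) := by
  show cexp (S.θ ((S.u : ℂ) * I)) = _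
  rw [Shear.θ_u_mul_I]

/-- `E u = p` when `ℓ = log p`. [folklore] -/
theorem E_u_of_log {p : ℕ} (hp : 0 < p) (hℓ : S.ℓ = Real.log p) : S.E (S.u : ℂ) = (p : ℂ) := by
  rw [E_u, hℓ, cexp_log_natCast hp]

/-- `E = exp` at `x + iy` whenever `φ x = φ y = 0`. [folklore] -/
theorem E_eq_exp_of {x y : ℝ} (hx : S.φ x = 0) (hy : S.φ y = 0) :
    S.E (x + y * I) = cexp (x + y * I) := by
  have hx' : S.φR x = 0 := by
    show ((S.φ x : A) : ℝ) = 0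
    rw [hx]
    rfl
  have hy' : S.φR y = 0 := by
    show ((S.φ y : A) : ℝ) = 0
    rw [hy]
    rfl
  show cexp (S.θ (x + y * I)) = _
  rw [Shear.θ_add, Shear.θ_ofReal, Shear.θ_ofReal_mul_I, hx', hy']
  simp only [zero_mul, add_zero]

/-! ### The transcendence package (E1)–(E4) of EVERY sheared exponential -/

/-- (E1) for every shear. [folklore] -/
theorem isInvolutiveExp_shear : IsInvolutiveExp S.E where
  map_add := S.E_add
  surj := fun _ hw => S.E_surjective hw
  kernel := ⟨S.τ, S.τ_ne_zero, S.conj_τ, S.E_eq_one_iff, S.E_τ_div_natCast⟩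
  map_conj := S.E_conj
  real_pos := S.E_ofReal_pos
  real_onto := fun _ ht => S.E_real_onto_pos ht
  imag_circle := S.norm_E_ofReal_mul_I
  imag_onto := fun _ hw => S.E_imag_onto_circle hw

/-- (E2) for every shear. [folklore] -/
theorem agreesOnQbar_shear : AgreesOnQbar S.E where
  eq_exp := fun _ hq => S.E_of_isAlgebraic hq
  transport := ⟨S.θ, S.θ_bijective, S.θ_one, fun _ z hq => S.θ_mul_of_mem (mem_Qb_iff.mpr hq) z,
    S.θ_add, fun _ => rfl⟩

/-- (E3) Hermite–Lindemann for every shear. [cite: Lindemann1882] -/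
theorem hermiteLindemannE_shear : HermiteLindemannE S.E := fun hα h0 => S.hermiteLindemann_E hα h0

/-- (E3) Lindemann–Weierstrass for every shear. [cite: Weierstrass1885] -/
theorem lindemannWeierstrassE_shear : LindemannWeierstrassE S.E :=
  fun α halg hli => S.lindemannWeierstrass_E α halg hli

/-- (E3) Gelfond–Schneider for every shear. [cite: Gelfond1934] -/
theorem gelfondSchneiderE_shear : GelfondSchneiderE S.E :=
  fun ha hb hbq hl hl0 => S.gelfondSchneider_E ha hb hbq hl hl0

/-- (E3) Baker for every shear. [cite: Baker1966, 68] -/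
theorem bakerE_shear : BakerE S.E := fun l halg hli => S.baker_E l halg hli

/-- (E4) `S_E(1)` for every shear. [folklore] -/
theorem schanuelRankE_shear_one : SchanuelRankE S.E 1 :=
  schanuelRankE_one_of_HL S.E (hermiteLindemannE_shear S)

/-- Every sheared exponential has the algebraic-point transcendence package of part TPF05.
[folklore] -/
theorem transcendencePackage_shear : TranscendencePackage S.E :=
  ⟨isInvolutiveExp_shear S, agreesOnQbar_shear S, lindemannWeierstrassE_shear S,
    hermiteLindemannE_shear S, gelfondSchneiderE_shear S, bakerE_shear S, schanuelRankE_shear_one S⟩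

/-- A pinned shear (`φ π = 0`) has the PERIOD PACKAGE of part PKF02, granted Nesterenko.
[cite: Nesterenko1996SbMath, Theorem 1 and its corollaries] -/
theorem periodPackage_of (hN : nesterenko) (h : S.φ Real.pi = 0) : PeriodPackage S.E :=
  ⟨transcendencePackage_shear S, trueKernel_of S h, agreesOnPeriodPlane_of S h, nesterenkoE_of S hN h⟩

end Pinned

end Summit.Schanuel.Schanuel.Theorems.RootDecomp1BFinitePinningFloor

end
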